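import Summits.QuantumFields.YangMills.Theorems.BalabanUVNodesN15KingModelGriffithsFiniteEta
import Literature.MathematicalPhysics.QuantumFieldTheory.King1986.MinimizerTowerBridge

/-!
# BalabanUVNodes ∕ N15 — THE KING-MODEL RUNG (PART Ϻ-l): STRICT POSITIVITY OF KING's FINITE-`η` KERNELS — THE STRONG MAXIMUM PRINCIPLE ON THE TORUS:
# `(N²(−Δ)+m²)⁻¹(z,z′) > 0` for ALL sites of every torus, hence `S₂^{(K)} > 0`, `(Δ^{(K)})⁻¹ > 0` entrywise, and every EVEN `n`-point function of King's finite-`η` block-field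
# laws is STRICTLY positive (Track A, DAG node N15 = NE2; FAN-OUT v1.1 §N15 s3 «KING-MODEL RUNG»; uses part Ϻ-k; count-neutral)

HONEST FRAMING.  Count-neutral (cell `pub-ymgap`, seat `pub-ymgap-dag-n15-e` g35; `--supports stmt-QuantumFields-27366 --as helper` = K3⁸).  King's `A = 0`, `g = 0` model
([King1986] C. King, Commun. Math. Phys. **102** (1986) 649–677).  Part Ϻ-k proved `(c(−Δ)+m²)⁻¹ ≥ 0` entrywise on every torus by the weak maximum principle.  THIS FILE
adds the STRONG maximum principle for `c > 0`: if `u ≥ 0`, `(c(−Δ)+m²)u ≥ 0` and `u` vanishes at one site, then `u` vanishes at its `2(d+1)` neighbours, hence — the torus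
`Π_μ ℤ∕K_μ` being connected under the steps `±e_μ` — everywhere; applied to a column of the inverse (which cannot vanish identically) this gives
★★ `(c(−Δ)+m²)⁻¹(z,z′) > 0` for ALL `z, z′` (`c > 0`, `m² > 0`).  Consequently King's finite-`η` block two-point function `S₂^{(K)} = N^{d+1}QB⁻¹Qᵀ` and NE2's unit kernel
`(Δ^{(K)})⁻¹ = a_K⁻¹·1 + S₂^{(K)}` are STRICTLY positive entrywise (every `N = L^K`, every volume), and by part Ϻ-e's `hafnian_pos_of_pos` every EVEN `n`-point function of the
block averages of the fine free field and of King's RG measures `dμ^{(K)}` is STRICTLY positive (odd ones vanish): Griffiths' first inequality in its strict form, at every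
finite lattice spacing `η = L^{−K}`.  NOT Bałaban's objects; NOT a node discharge; nothing continuum-Yang–Mills ∕ `ℝ⁴` ∕ OS ∕ Clay.  0 `sorry`, 0 def; standard axioms.

WHAT THIS FILE PROVES (kernel).  §1 `nbr_eq_zero_of_eq_zero` (a zero of a non-negative supersolution spreads to the neighbours), `add_natMul_unitVec_eq_zero`, `add_single_eq_zero`, `eq_zero_everywhere`
(torus connectivity), ★★ **`lapF_inv_pos`** (strong maximum principle).  §2 `exists_blockOf_eq`, ★★★ **`kingS2_pos`**, ★★ **`blockCov_pos`**.  §3 ★★★ **`nPoint_fineBlockLaw_pos`**,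
★★★ **`nPoint_blockFieldLaw_pos`** (`|S|` even), `nPoint_fineBlockLaw_pos_iff_even`.

HONEST SCOPE.  King's free model at finite `η`; the `K = ∞` ∕ `|Ω| = ∞` strict statements are parts Ϻ-b∕e (the finite-`η` limits `S₂^{(∞)}`, `C^{(∞)}` are only shown `≥ 0` in part Ϻ-k).
N15 untouched; counts unmoved.  Locators (use): [King1986] (2.4)–(2.6) p.652, (2.13)–(2.14) p.653, Thm 2.1 (2.23) p.654, (4.4)–(4.5) p.670.
-/

noncomputable section

open scoped BigOperators Topology
open Filter MeasureTheory Finset Matrix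

namespace Summit.QuantumFields.YangMills.BalabanUVNodes.N15KingModelRung.ProperTime

open Literature.MathematicalPhysics.QuantumFieldTheory.Balaban1983to89.B5Prop11Plancherel (Tor fine unitVec)
open Literature.MathematicalPhysics.QuantumFieldTheory.King1986.Torus
open Literature.MathematicalPhysics.QuantumFieldTheory.King1986 (aK aK_pos)
open Literature.Combinatorics.Enumerative (hafnian)
open Literature.Combinatorics.Enumerative.HafnianGeneratingFunction (subMat)
open FreeField

variable {d : ℕ}

/-! ## §1 The strong maximum principle on the torus -/

section Strong

variable {n : ℕ} (K : Fin n → ℕ) [hK : ∀ μ, NeZero (K μ)]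

/-- **A zero spreads to the neighbours**: if `u ≥ 0`, `((c(−Δ)+m²)u)(z) ≥ 0`, `c > 0` and `u(z) = 0`, then `u(z ± e_μ) = 0` for every `μ`. [folklore] -/
theorem nbr_eq_zero_of_eq_zero {c m2 : ℝ} (hc : 0 < c) {u : Tor K → ℝ} (hu : ∀ w, 0 ≤ u w) {z : Tor K} (hBz : 0 ≤ (lapF K c m2).mulVec u z) (hz : u z = 0)
    (μ : Fin n) : u (z + unitVec K μ) = 0 ∧ u (z - unitVec K μ) = 0 := by
  rw [lapF_mulVec_apply K c m2 u z, hz, mul_zero, zero_sub, neg_nonneg] at hBz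
  have hsum : ∑ ν, (u (z + unitVec K ν) + u (z - unitVec K ν)) ≤ 0 := by
    have := (mul_nonpos_iff.mp hBz)
    rcases this with ⟨_, h⟩ | ⟨h, _⟩
    · exact h
    · exact absurd h (not_le.mpr hc)
  have hnn : ∀ ν ∈ Finset.univ, 0 ≤ u (z + unitVec K ν) + u (z - unitVec K ν) := fun ν _ => add_nonneg (hu _) (hu _)
  have h0 : ∑ ν, (u (z + unitVec K ν) + u (z - unitVec K ν)) = 0 := le_antisymm hsum (Finset.sum_nonneg hnn)
  have hμ := (Finset.sum_eq_zero_iff_of_nonneg hnn).mp h0 μ (Finset.mem_univ μ)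
  constructor <;> linarith [hu (z + unitVec K μ), hu (z - unitVec K μ)]

/-- Induction along a coordinate: a zero at `z` forces a zero at `z + k·e_μ` for every `k : ℕ`. [folklore] -/
theorem add_natMul_unitVec_eq_zero {c m2 : ℝ} (hc : 0 < c) {u : Tor K → ℝ} (hu : ∀ w, 0 ≤ u w) (hB : ∀ w, 0 ≤ (lapF K c m2).mulVec u w) {z : Tor K} (hz : u z = 0)
    (μ : Fin n) (k : ℕ) : u (z + Pi.single μ (k : ZMod (K μ))) = 0 := by
  induction k with
  | zero => simpa using hz
  | succ k ih =>
    have hstep := (nbr_eq_zero_of_eq_zero K hc hu (hB _) ih μ).1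
    have he : z + Pi.single μ ((k : ℕ) : ZMod (K μ)) + unitVec K μ = z + Pi.single μ (((k + 1 : ℕ)) : ZMod (K μ)) := by
      rw [unitVec, add_assoc, ← Pi.single_add, Nat.cast_succ]
    rw [← he]
    exact hstep

/-- A zero at `z` forces a zero at `z + t·e_μ` for every `t ∈ ℤ∕K_μ`. [folklore] -/
theorem add_single_eq_zero {c m2 : ℝ} (hc : 0 < c) {u : Tor K → ℝ} (hu : ∀ w, 0 ≤ u w) (hB : ∀ w, 0 ≤ (lapF K c m2).mulVec u w) {z : Tor K} (hz : u z = 0)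
    (μ : Fin n) (t : ZMod (K μ)) : u (z + Pi.single μ t) = 0 := by
  have ht : t = ((t.val : ℕ) : ZMod (K μ)) := (ZMod.natCast_zmod_val t).symm
  rw [ht]
  exact add_natMul_unitVec_eq_zero K hc hu hB hz μ t.val

/-- **Torus connectivity**: a zero at one site forces `u ≡ 0`. [folklore] -/
theorem eq_zero_everywhere {c m2 : ℝ} (hc : 0 < c) {u : Tor K → ℝ} (hu : ∀ w, 0 ≤ u w) (hB : ∀ w, 0 ≤ (lapF K c m2).mulVec u w) {z : Tor K} (hz : u z = 0)
    (w : Tor K) : u w = 0 := by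
  -- move from `z` to `w = z + Σ_μ single μ (w − z)_μ`, one coordinate at a time
  have key : ∀ s : Finset (Fin n), u (z + ∑ μ ∈ s, Pi.single μ ((w - z) μ)) = 0 := by
    intro s
    induction s using Finset.induction_on with
    | empty => simpa using hz
    | insert μ s hμs ih =>
      rw [Finset.sum_insert hμs, add_comm (Pi.single μ _) _, ← add_assoc]
      exact add_single_eq_zero K hc hu hB ih μ _
  have h := key Finset.univ
  rwa [Finset.univ_sum_single (w - z), add_sub_cancel] at h

/-- ★★ **THE STRONG MAXIMUM PRINCIPLE ∕ STRICT INVERSE POSITIVITY**: for `c > 0`, `m² > 0` and ALL sites `z, z′` of ANY torus `Π_μ ℤ∕K_μ`,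
`((c(−Δ)+m²)⁻¹)(z,z′) > 0`. [cite: King1986, (4.4) p.670, (2.13) p.653] -/
theorem lapF_inv_pos {c m2 : ℝ} (hc : 0 < c) (hm : 0 < m2) (z z' : Tor K) : 0 < (lapF K c m2)⁻¹ z z' := by
  set u : Tor K → ℝ := fun w => (lapF K c m2)⁻¹ w z' with hu_def
  have hu : ∀ w, 0 ≤ u w := fun w => lapF_inv_nonneg K hc.le hm w z'
  have hdet : IsUnit (lapF K c m2).det := (Matrix.isUnit_iff_isUnit_det _).mp (isUnit_lapF K hc.le hm)
  have hcol : ∀ w, (lapF K c m2).mulVec u w = if w = z' then 1 else 0 := by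
    intro w
    have : (lapF K c m2).mulVec u w = ((lapF K c m2) * (lapF K c m2)⁻¹) w z' := by
      simp only [hu_def, Matrix.mulVec, dotProduct, Matrix.mul_apply]
    rw [this, Matrix.mul_nonsing_inv _ hdet, Matrix.one_apply]
  have hB : ∀ w, 0 ≤ (lapF K c m2).mulVec u w := fun w => by rw [hcol w]; split_ifs <;> norm_num
  rcases (hu z).eq_or_lt with h0 | hpos
  · -- `u z = 0` would force `u ≡ 0`, contradicting `(Bu)(z′) = 1`
    exfalso
    have hall := eq_zero_everywhere K hc hu hB h0.symm
    have h1 := hcol z'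
    rw [if_pos rfl, lapF_mulVec_apply K c m2 u z'] at h1
    simp only [hall, mul_zero, add_zero, Finset.sum_const_zero, sub_zero] at h1
    exact zero_ne_one h1
  · exact hpos

end Strong

/-! ## §2 Strict positivity of `S₂^{(K)}` and `(Δ^{(K)})⁻¹` -/

section Kernels

variable (L : ℕ) (M : Fin (d + 1) → ℕ) [hM : ∀ ν, NeZero (M ν)]

omit hM in
/-- Every block is non-empty: `b = ⌊z∕N⌋` for some fine site `z` (the corner of the block). [folklore] -/
theorem exists_blockOf_eq [∀ ν, NeZero (M ν)] (N : ℕ) [NeZero N] (b : Tor M) : ∃ z : Tor (fine N M), blockOf N M z = b :=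
  ⟨site N M b (fun _ => ⟨0, Nat.pos_of_ne_zero (NeZero.ne N)⟩), blockOf_site N M b _⟩

omit hM in
/-- ★★★ **KING's FINITE-`η` BLOCK TWO-POINT FUNCTION IS STRICTLY POSITIVE ENTRYWISE**: `S₂^{(K)}(b,b′) > 0` for every fine level `N ≥ 1`, every volume, all `b, b′` (`m² > 0`).
[cite: King1986, (2.13)–(2.14) p.653, Thm 2.1 (2.23) p.654] -/
theorem kingS2_pos [∀ ν, NeZero (M ν)] (N : ℕ) [NeZero N] {m2 : ℝ} (hm : 0 < m2) (b b' : Tor M) : 0 < kingS2 N M m2 b b' := by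
  have hN : (0 : ℝ) < N := by exact_mod_cast Nat.pos_of_ne_zero (NeZero.ne N)
  obtain ⟨z₀, hz₀⟩ := exists_blockOf_eq M N b
  obtain ⟨z₀', hz₀'⟩ := exists_blockOf_eq M N b'
  unfold kingS2
  refine mul_pos (by positivity) ?_
  rw [Matrix.mul_apply]
  -- every term is `≥ 0`; the term `(z₀, z₀′)` is `> 0`
  have hterm : ∀ w, 0 ≤ (Qmat N M * (lapF (fine N M) (((N : ℕ) : ℝ) ^ 2) m2)⁻¹) b w * (Qmat N M)ᵀ w b' := fun w => by
    refine mul_nonneg ?_ (by rw [Matrix.transpose_apply]; exact Qmat_nonneg N M b' w)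
    rw [Matrix.mul_apply]
    exact Finset.sum_nonneg fun z _ => mul_nonneg (Qmat_nonneg N M b z) (lapF_inv_nonneg (fine N M) (by positivity) hm z w)
  refine lt_of_lt_of_le ?_ (Finset.single_le_sum (fun w _ => hterm w) (Finset.mem_univ z₀'))
  have hQ' : 0 < (Qmat N M)ᵀ z₀' b' := by
    rw [Matrix.transpose_apply, Qmat, if_pos hz₀']; positivity
  refine mul_pos ?_ hQ'
  rw [Matrix.mul_apply]
  have hinner : ∀ z, 0 ≤ Qmat N M b z * (lapF (fine N M) (((N : ℕ) : ℝ) ^ 2) m2)⁻¹ z z₀' := fun z =>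
    mul_nonneg (Qmat_nonneg N M b z) (lapF_inv_nonneg (fine N M) (by positivity) hm z z₀')
  refine lt_of_lt_of_le ?_ (Finset.single_le_sum (fun z _ => hinner z) (Finset.mem_univ z₀))
  have hQ : 0 < Qmat N M b z₀ := by rw [Qmat, if_pos hz₀]; positivity
  exact mul_pos hQ (lapF_inv_pos (fine N M) (by positivity) hm z₀ z₀')

/-- ★★ **NE2's UNIT KERNEL IS STRICTLY POSITIVE ENTRYWISE** at every finite `K ≥ 1`: `(Δ^{(K)})⁻¹(b,b′) > 0` (`L ≥ 2`, `a, m² > 0`). [cite: King1986, (2.14) p.653, (4.5) p.670] -/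
theorem blockCov_pos (hL : 2 ≤ L) {a m2 : ℝ} (ha : 0 < a) (hm : 0 < m2) {K : ℕ} (hK : 1 ≤ K) (b b' : Tor M) :
    haveI : NeZero L := ⟨by omega⟩
    0 < blockCov L (L ^ K) M a m2 K b b' := by
  haveI : NeZero L := ⟨by omega⟩
  have hL1 : (1 : ℝ) < L := by exact_mod_cast (show 1 < L by omega)
  rw [blockCov_eq_kingS2_add_noise L M hL ha hm hK]
  refine add_pos_of_pos_of_nonneg (kingS2_pos M (L ^ K) hm b b') (mul_nonneg (inv_nonneg.mpr (aK_pos ha hL1 hK).le) ?_)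
  split_ifs <;> norm_num

end Kernels

/-! ## §3 Strict Griffiths I at finite `η` -/

section NPoint

variable (L : ℕ) (M : Fin (d + 1) → ℕ) [hM : ∀ ν, NeZero (M ν)]
variable {W : Type*} [DecidableEq W] [LinearOrder W]

/-- ★★★ **STRICT GRIFFITHS I, FINE BLOCK AVERAGES**: for `|S|` EVEN, every fine level `N`, every volume and `m² > 0`, `0 < ∫∏_{i∈S}φ(p_i)ρ_{P_N}(φ)dφ`.
[cite: King1986, (2.6) p.652, (2.13) p.653, Thm 2.1 (2.23) p.654] -/
theorem nPoint_fineBlockLaw_pos (N : ℕ) [NeZero N] {m2 : ℝ} (hm : 0 < m2) (p : W → Tor M) {S : Finset W} (hS : Even S.card) :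
    0 < ∫ φ : Tor M → ℝ, (∏ i ∈ S, φ (p i)) * gaussDensity (fineBlockPrec M N m2) φ := by
  rw [integral_prod_eval_fineBlockLaw_eq_hafnian M N hm p S]
  exact hafnian_pos_of_pos (fun u v => kingS2_pos M N hm _ _) (by rwa [Fintype.card_coe])

/-- ★★★ **STRICT GRIFFITHS I, KING's RG MEASURES**: for `|S|` EVEN, `L ≥ 2`, `a, m² > 0`, `K ≥ 1`, every volume: `0 < ∫∏_{i∈S}ψ(p_i)dμ^{(K)}(ψ)`.
[cite: King1986, (2.10)–(2.14) pp.652–653, (4.5) p.670] -/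
theorem nPoint_blockFieldLaw_pos (hL : 2 ≤ L) {a m2 : ℝ} (ha : 0 < a) (hm : 0 < m2) {K : ℕ} (hK : 1 ≤ K) (p : W → Tor M) {S : Finset W} (hS : Even S.card) :
    haveI : NeZero L := ⟨by omega⟩
    0 < ∫ ψ : Tor M → ℝ, (∏ i ∈ S, ψ (p i)) * gaussDensity (effLaplacian (L ^ K) M (aK a L K) (((L ^ K : ℕ) : ℝ) ^ 2) m2) ψ := by
  haveI : NeZero L := ⟨by omega⟩
  rw [integral_prod_eval_blockFieldLaw_eq_hafnian L M hL ha hm hK p S]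
  exact hafnian_pos_of_pos (fun u v => blockCov_pos L M hL ha hm hK _ _) (by rwa [Fintype.card_coe])

/-- ★★ **Parity dichotomy at finite `η`**: the `|S|`-point function of the fine block averages is `> 0` iff `|S|` is even (`= 0` for odd `|S|`, part Ͱ-c).
[cite: King1986, (2.13) p.653, Thm 2.1 (2.23) p.654] -/
theorem nPoint_fineBlockLaw_pos_iff_even (N : ℕ) [NeZero N] {m2 : ℝ} (hm : 0 < m2) (p : W → Tor M) (S : Finset W) :
    0 < ∫ φ : Tor M → ℝ, (∏ i ∈ S, φ (p i)) * gaussDensity (fineBlockPrec M N m2) φ ↔ Even S.card := by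
  refine ⟨fun h => ?_, nPoint_fineBlockLaw_pos M N hm p⟩
  by_contra hodd
  rw [Nat.not_even_iff_odd] at hodd
  rw [integral_prod_eval_fineBlockLaw_eq_hafnian M N hm p S, hafnian_eq_zero_of_odd_card (by rwa [Fintype.card_coe]) _] at h
  exact lt_irrefl _ h

end NPoint

end Summit.QuantumFields.YangMills.BalabanUVNodes.N15KingModelRung.ProperTime
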